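import Mathlib
import Literature.MathematicalPhysics.QuantumFieldTheory.Balaban1983to89.B1RT
import Literature.MathematicalPhysics.QuantumFieldTheory.Balaban1983to89.B2LargeField

/-!
# `Balaban1983to89.B2Sect3BSmallFactors` — T. Bałaban, *(Higgs)₂,₃ quantum fields in a finite volume. II. An
upper bound*, Commun. Math. Phys. **86** (1982) 555–594 [Balaban1982Higgs2]: Sect. 3.B *"The basic estimate
giving the small factors"*, p. 590 — the one-site Gaussian LARGE-FIELD TAIL (3.33), the normalisation (3.32),
and the two exponential bookkeeping steps (3.30), (3.31); PROVED (theorems only)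

statement-level skeleton of published theorems with citation tags; proofs where landed; nothing here is a claim about the Yang–Mills mass gap

PDF held: `paper:balaban1982-cmp86-higgs23-ii` (journal page = PDF page + 554); (3.26)–(3.33) read from the ×2 renders
`run/shared/lean/pub/pub-balaban/b2b-balaban-ref1/pages/1982-cmp86-higgs23-II/1982-cmp86-higgs23-II-p035-x2.png`,
`…-p036-x2.png` (pp. 589–590).

WHAT IS REPRODUCED.  Members of SKELETON row **B2.Eq3.32** ((3.30)–(3.41) p. 590–592, *"esp. (3.32)"*; fold owner
r02; status before this file: (3.32) `proved p238968` under part I's locator only (`B1RT.integral_rtKernel_sub` =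
I (2.8)), everything else `absent`).  PROVED here, over r14's Gaussian kernel `B1RT.rtKernel κ v = (κ/2π)^{N/2}
e^{−½κ‖v‖²}` (N = dim V, κ = a(L^kε)^{d−2} = `B1RT.prec a (L^kε) d`):
* **(3.33)** `ineq333_first` / `ineq333` / `ineq333_printed`: ∫dφ χ({ℓ^{d−2}‖φ − m‖² > p(ℓ)²})·t_{aℓ^{d−2}}(φ − m)
  ≤ 2^{N/2}e^{−¼ap(ℓ)²} ≤ e^{−⅛ap(ℓ)²}; the pointwise mechanism `indicator_mul_rtKernel_le` (on the large-field
  region e^{−½κ‖v‖²} ≤ e^{−¼ap²}·e^{−¼κ‖v‖²}) and the mass of the half-precision kernel `integral_two_rpow_mul_rtKernel_half`;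
  the second "≤" of (3.33) needs 2^{N/2} ≤ e^{⅛ap(ℓ)²}, i.e. 4N log 2 ≤ a p(ℓ)² (`two_rpow_mul_exp_le`) — printed
  without comment, automatic at every scale ℓ = L^kε ≤ 1 once a b₀² ≥ 4N log 2 (`hyp333_of_b0`, from `b0_le_pFn`:
  p(ℓ) ≥ b₀), which is how it is stated in `ineq333_printed`;
* **(3.32)** `eq332`: the normalisation ∫dφ_{k+l}(y) t(φ_{k+l}(y), φ_k↾B^l(y)) = 1 as a B2-located decl (= I (2.8));
* **(3.30)** `ineq330`: Z e^{−½X} ≤ Z e^{−¼X} e^{−¼R} from Prop 3.1's X = ⟨Φ, Δ(Ã^ε)Φ⟩ ≥ R = right side of (3.26);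
* **(3.31)** `ineq331` / `ineq331_printed`: χ^c_Q · e^{−¼(k-th term of (3.26))} ≤ e^{−¼γ₀p(L^kε)²|Q| + O((L^kε)^{κ₀})|Λ_k|}.
KERNEL: Mathlib Gaussian integral through `B1RT.integral_rtKernel_sub`, `Real.rpow`, monotonicity of the Bochner
integral; no new definitions.  NOT HERE: the multi-scale integrals (3.21)–(3.25), (3.34)–(3.41) (rows B2.Eq3.25,
B2.Eq3.32 rest), Prop 3.1 itself (`B2.Prop31Printed`, typed-existing), the diamagnetic inequality (3.38) ([I.5] =
Brydges–Fröhlich–Seiler, NOT HELD).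

Unit `lit-balaban-r14` gen 3 (reader/typer of B1–B2), HOME `run/shared/lean/pub/lit-balaban/`.

THE SOURCE TEXT, verbatim (p. 590 [PDF 36]).  *"Now let us come back to the expression (3.22). The part of it
standing on the right of the characteristic functions is equal to Z(Ã^ε)exp(−½⟨Φ, Δ(Ã^ε)Φ⟩), where all the constants
coming from the renormalization transformations are included in Z(Ã^ε). We use Proposition 3.1 and we obtain
Z(Ã^ε)exp(−½⟨Φ, Δ(Ã^ε)Φ⟩) ≤ Z(Ã^ε)exp(−¼⟨Φ, Δ(Ã^ε)Φ⟩)·exp(−¼(the right side of (3.26))). (3.30)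
Now we estimate the characteristic functions by 1, except the functions ζ_{Λ₀^{(k)}}. These contain the functions
χ^c_{Q_s^{(k)}}, which give the restrictions of the form (L^kε)^{d−2}|U(Ã^ε(⟨x,x′⟩))φ_k(x′) − φ_k(x)|² > p(L^kε)² for all
the bonds ⟨x,x′⟩ ∈ Q_s^{(k)}. The bonds of this set are contained in Λ₇^{(k−1)′} ∩ Λ₀^{(k)c} ⊂ Λ₅^{(k−1)′} ∩ Λ₅^{(k)c},
hence χ^c_{Q_s^{(k)}} exp(−¼(k-th term of the right side of (3.26))) ≤ exp(−¼γ₀p(L^kε)²|Q_s^{(k)}| + O((L^kε)^{κ₀})|Λ_k|).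
(3.31) Further, because there are no characteristic functions on the right side of (3.22) except the functions
remaining in ζ_{Λ₀^{(k)}}, so we can integrate with some exceptions, with respect to the fields φ_K↾Λ₅^{(K−1)′c},
φ_{K−1}↾Λ₅^{(K−2)′c}, …, φ₁↾Λ₅^{(0)′c}, using the normalization properties of the renormalization transformations
∫dφ_{k+l}(y) t^{L^kε}_{a_l,L^l,A}(φ_{k+l}(y), φ_k↾B^l(y)) = 1. (3.32) The exceptions are when we integrate over
φ_{k+1}(y) with the points y ∈ P_s^{(k)}. In this case the characteristic functions χ^c_{P_s^{(k)}} give the restrictions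
(L^kε)^{d−2}|φ_{k+1}(y) − (Q(Ã^ε)φ_k)(y)|² > p(L^kε)², and instead of the integral (3.32) we have
∫dφ_{k+1}(y) χ({(L^kε)^{d−2}|φ_{k+1}(y) − (Q(Ã^ε)φ_k)(y)|² > p(L^kε)²}) (a(L^kε)^{d−2}/2π)^{N/2} exp[−½a(L^kε)^{d−2}
·|φ_{k+1}(y) − (Q(Ã^ε)φ_k)(y)|²] ≤ 2^{N/2} exp(−¼ap(L^kε)²) ≤ exp(−⅛ap(L^kε)²). (3.33)"*  (The exponents N/2 are
printed "1/2N"; read as (½)N, consistent with the kernel (2.6)/(2.10) of part I.)  The k-th term of the right side of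
(3.26) (p. 589, Prop. 3.1): γ₀Σ_{⟨x,x′⟩⊂Λ₅^{(k−1)′}∩Λ₅^{(k)c}}(L^kε)^{d−2}|U(Ã^ε(⟨x,x′⟩))φ_k(x′) − φ_k(x)|² +
γ₀Σ_{x∈Λ₅^{(k−1)′}∩Λ₅^{(k)c}}(L^kε)^d m²|φ_k(x)|² − O((L^kε)^{κ₀})|(Λ₅^{(k−1)′} ∩ Λ₅^{(k)c})₁|.

DICTIONARY (abstract ↤ printed).  `V` ↤ ℝ^N (values of the scalar field), `Module.finrank ℝ V` ↤ N; `ℓ` ↤ L^kε,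
`s` ↤ ℓ^{d−2}, `a` ↤ the constant a of the renormalization transformation, κ = a·s = `B1RT.prec a ℓ d`; `m` ↤
(Q(Ã^ε)φ_k)(y); `P` ↤ p(L^kε)² = (`B2.pFn b₀ p ℓ`)²; the indicator `if P < s‖φ − m‖² then 1 else 0` ↤ χ({(L^kε)^{d−2}
|φ_{k+1}(y) − (Q(Ã^ε)φ_k)(y)|² > p(L^kε)²}); in (3.30): `Z` ↤ Z(Ã^ε) ≥ 0, `X` ↤ ⟨Φ, Δ(Ã^ε)Φ⟩, `R` ↤ the right side of
(3.26) (Prop 3.1: X ≥ R); in (3.31): `t b` ↤ (L^kε)^{d−2}|U(Ã^ε(⟨x,x′⟩))φ_k(x′) − φ_k(x)|² ≥ 0 for the bonds b of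
`Bk` ↤ (Λ₅^{(k−1)′} ∩ Λ₅^{(k)c})*, `Q` ⊆ `Bk` ↤ Q_s^{(k)}, `M` ↤ the mass sum ≥ 0, `γ₀` ↤ γ₀ > 0 of Prop 3.1, `E` ↤
the printed O((L^kε)^{κ₀})|Λ_k| ≥ 0, `χ` ↤ the value of χ^c_{Q_s^{(k)}} ∈ {0,1} (= 1 forces t b > P on Q).
-/

namespace Literature.MathematicalPhysics.QuantumFieldTheory.Balaban1983to89.B2Sect3BSmallFactors

open _root_.MeasureTheory _root_.Real
open Finset

/-! ## (3.30), (3.31) p. 590: the exponential bookkeeping — KERNEL -/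

/-- **(3.30)** p. 590, KERNEL: from Prop 3.1 (X = ⟨Φ, Δ(Ã^ε)Φ⟩ ≥ R = the right side of (3.26)) and Z(Ã^ε) ≥ 0,
Z e^{−½X} ≤ Z e^{−¼X} · e^{−¼R}. [cite: Balaban1982Higgs2, (3.30) p.590] -/
theorem ineq330 {Z X R : ℝ} (hZ : 0 ≤ Z) (hX : R ≤ X) :
    Z * Real.exp (-(X / 2)) ≤ Z * Real.exp (-(X / 4)) * Real.exp (-(R / 4)) := by
  rw [mul_assoc, ← Real.exp_add]
  exact mul_le_mul_of_nonneg_left (Real.exp_le_exp.2 (by linarith)) hZ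

/-- **(3.31)** p. 590, KERNEL: the k-th term of the right side of (3.26) is T = γ₀(Σ_{b∈Bk} t_b + M) − E with bond
terms t_b ≥ 0, mass part M ≥ 0, γ₀ ≥ 0; when χ^c_{Q} = 1 every bond b ∈ Q ⊆ Bk has t_b > P = p(L^kε)², hence
χ^c_Q · e^{−¼T} ≤ e^{−¼γ₀P|Q| + ¼E}. [cite: Balaban1982Higgs2, (3.31) p.590] -/
theorem ineq331 {ι : Type*} (Bk Q : Finset ι) (hQ : Q ⊆ Bk) (t : ι → ℝ) (ht : ∀ b ∈ Bk, 0 ≤ t b)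
    {γ₀ M E P χ : ℝ} (hγ : 0 ≤ γ₀) (hM : 0 ≤ M) (hχ : χ = 0 ∨ χ = 1) (hlarge : χ = 1 → ∀ b ∈ Q, P < t b) :
    χ * Real.exp (-((γ₀ * (∑ b ∈ Bk, t b + M) - E) / 4))
      ≤ Real.exp (-(γ₀ * P * Q.card / 4) + E / 4) := by
  rcases hχ with h0 | h1
  · rw [h0, zero_mul]
    exact (Real.exp_pos _).le
  · rw [h1, one_mul]
    refine Real.exp_le_exp.2 ?_
    have hQsum : P * Q.card ≤ ∑ b ∈ Q, t b := by
      calc P * Q.card = ∑ _b ∈ Q, P := by rw [Finset.sum_const, nsmul_eq_mul, mul_comm]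
        _ ≤ ∑ b ∈ Q, t b := Finset.sum_le_sum fun b hb => (hlarge h1 b hb).le
    have hBQ : ∑ b ∈ Q, t b ≤ ∑ b ∈ Bk, t b :=
      Finset.sum_le_sum_of_subset_of_nonneg hQ fun b hb _ => ht b hb
    have : γ₀ * (P * Q.card) ≤ γ₀ * (∑ b ∈ Bk, t b + M) :=
      mul_le_mul_of_nonneg_left (by linarith) hγ
    linarith

/-- **(3.31)** in the printed shape (the O(·) absorbing the ¼): for E ≥ 0, χ^c_Q · e^{−¼T} ≤ e^{−¼γ₀P|Q| + E}.
[cite: Balaban1982Higgs2, (3.31) p.590] -/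
theorem ineq331_printed {ι : Type*} (Bk Q : Finset ι) (hQ : Q ⊆ Bk) (t : ι → ℝ) (ht : ∀ b ∈ Bk, 0 ≤ t b)
    {γ₀ M E P χ : ℝ} (hγ : 0 ≤ γ₀) (hM : 0 ≤ M) (hE : 0 ≤ E) (hχ : χ = 0 ∨ χ = 1)
    (hlarge : χ = 1 → ∀ b ∈ Q, P < t b) :
    χ * Real.exp (-((γ₀ * (∑ b ∈ Bk, t b + M) - E) / 4))
      ≤ Real.exp (-(γ₀ * P * Q.card / 4) + E) :=
  (ineq331 Bk Q hQ t ht hγ hM hχ hlarge).trans (Real.exp_le_exp.2 (by linarith))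

/-! ## (3.32), (3.33) p. 590: the one-site Gaussian integrals — KERNEL over `B1RT.rtKernel` -/

section GaussTail

variable {V : Type*} [NormedAddCommGroup V] [InnerProductSpace ℝ V] [FiniteDimensional ℝ V]
  [MeasurableSpace V] [BorelSpace V]

/-- **(3.32)** p. 590 (= part I (2.8), there `B1RT.integral_rtKernel_sub`), in the coordinates of Sect. 3.B: the
one-site kernel of precision a·ℓ^{d−2} = `B1RT.prec a ℓ d` centred at the block average m integrates to 1.
[cite: Balaban1982Higgs2, (3.32) p.590] -/
theorem eq332 {a ℓ : ℝ} (ha : 0 < a) (hℓ : 0 < ℓ) (d : ℕ) (m : V) :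
    ∫ φ : V, B1RT.rtKernel (B1RT.prec a ℓ d) (φ - m) = 1 :=
  B1RT.integral_rtKernel_sub (B1RT.prec_pos ha hℓ d) m

omit [FiniteDimensional ℝ V] [MeasurableSpace V] [BorelSpace V] in
/-- The POINTWISE MECHANISM of (3.33): on the large-field region P < s‖v‖² the kernel of precision a·s splits off
the small factor, t_{as}(v)·χ ≤ e^{−¼aP} · 2^{N/2} t_{as/2}(v) (since e^{−½κ‖v‖²} = e^{−¼κ‖v‖²}e^{−¼κ‖v‖²} and
¼κ‖v‖² > ¼aP there), and (κ/2π)^{N/2} = 2^{N/2}(κ/4π)^{N/2}. [cite: Balaban1982Higgs2, (3.33) p.590] -/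
theorem indicator_mul_rtKernel_le {a s P : ℝ} (ha : 0 ≤ a) (hs : 0 ≤ s) (v : V) :
    (if P < s * ‖v‖ ^ 2 then (1 : ℝ) else 0) * B1RT.rtKernel (a * s) v
      ≤ Real.exp (-(a * P / 4)) *
        ((2 : ℝ) ^ ((Module.finrank ℝ V : ℝ) / 2) * B1RT.rtKernel (a * s / 2) v) := by
  have hκ : 0 ≤ a * s := mul_nonneg ha hs
  -- the constant identity 2^{N/2} (κ/2/(2π))^{N/2} = (κ/(2π))^{N/2}
  have hconst : (2 : ℝ) ^ ((Module.finrank ℝ V : ℝ) / 2) * (a * s / 2 / (2 * π)) ^ ((Module.finrank ℝ V : ℝ) / 2)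
      = (a * s / (2 * π)) ^ ((Module.finrank ℝ V : ℝ) / 2) := by
    rw [← Real.mul_rpow (by norm_num) (by positivity)]
    congr 1
    ring
  have hrhs : Real.exp (-(a * P / 4)) *
        ((2 : ℝ) ^ ((Module.finrank ℝ V : ℝ) / 2) * B1RT.rtKernel (a * s / 2) v)
      = (a * s / (2 * π)) ^ ((Module.finrank ℝ V : ℝ) / 2) *
          (Real.exp (-(a * P / 4)) * Real.exp (-(a * s / 2 / 2) * ‖v‖ ^ 2)) := by
    rw [B1RT.rtKernel_eq, ← mul_assoc ((2 : ℝ) ^ _), hconst]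
    ring
  rw [hrhs]
  split_ifs with hP
  · rw [one_mul, B1RT.rtKernel_eq]
    refine mul_le_mul_of_nonneg_left ?_ (Real.rpow_nonneg (by positivity) _)
    rw [← Real.exp_add]
    refine Real.exp_le_exp.2 ?_
    have h1 : a * P ≤ a * (s * ‖v‖ ^ 2) := mul_le_mul_of_nonneg_left hP.le ha
    nlinarith
  · rw [zero_mul]
    positivity

/-- The dominating function of (3.33) has mass 2^{N/2}: ∫ 2^{N/2} t_{κ/2}(φ − m) dφ = 2^{N/2} ((3.32) at precision κ/2).
[cite: Balaban1982Higgs2, (3.33) p.590] -/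
theorem integral_two_rpow_mul_rtKernel_half {κ : ℝ} (hκ : 0 < κ) (m : V) :
    ∫ φ : V, (2 : ℝ) ^ ((Module.finrank ℝ V : ℝ) / 2) * B1RT.rtKernel (κ / 2) (φ - m)
      = (2 : ℝ) ^ ((Module.finrank ℝ V : ℝ) / 2) := by
  rw [integral_const_mul, B1RT.integral_rtKernel_sub (by positivity) m, mul_one]

/-- **(3.33), FIRST INEQUALITY** p. 590, PROVED: ∫dφ χ({s‖φ − m‖² > P}) t_{as}(φ − m) ≤ 2^{N/2} e^{−¼aP} for a, s > 0
(s = (L^kε)^{d−2}, P = p(L^kε)², m = (Q(Ã^ε)φ_k)(y)). [cite: Balaban1982Higgs2, (3.33) p.590] -/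
theorem ineq333_first {a s P : ℝ} (ha : 0 < a) (hs : 0 < s) (m : V) :
    ∫ φ : V, (if P < s * ‖φ - m‖ ^ 2 then (1 : ℝ) else 0) * B1RT.rtKernel (a * s) (φ - m)
      ≤ (2 : ℝ) ^ ((Module.finrank ℝ V : ℝ) / 2) * Real.exp (-(a * P / 4)) := by
  have hκ2 : 0 < a * s / 2 := by positivity
  have hint : Integrable (fun φ : V => Real.exp (-(a * P / 4)) *
      ((2 : ℝ) ^ ((Module.finrank ℝ V : ℝ) / 2) * B1RT.rtKernel (a * s / 2) (φ - m))) :=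
    ((B1RT.integrable_rtKernel_sub hκ2 m).const_mul _).const_mul _
  calc ∫ φ : V, (if P < s * ‖φ - m‖ ^ 2 then (1 : ℝ) else 0) * B1RT.rtKernel (a * s) (φ - m)
      ≤ ∫ φ : V, Real.exp (-(a * P / 4)) *
          ((2 : ℝ) ^ ((Module.finrank ℝ V : ℝ) / 2) * B1RT.rtKernel (a * s / 2) (φ - m)) := by
        refine integral_mono_of_nonneg (ae_of_all _ fun φ => ?_) hint
          (ae_of_all _ fun φ => indicator_mul_rtKernel_le ha.le hs.le (φ - m))
        exact mul_nonneg (by split_ifs <;> norm_num) (B1RT.rtKernel_nonneg (by positivity) _)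
    _ = (2 : ℝ) ^ ((Module.finrank ℝ V : ℝ) / 2) * Real.exp (-(a * P / 4)) := by
        rw [integral_const_mul, show a * s / 2 = (a * s) / 2 from rfl,
          integral_two_rpow_mul_rtKernel_half (by positivity) m, mul_comm]

/-- The SECOND "≤" of (3.33): 2^{N/2} e^{−¼aP} ≤ e^{−⅛aP} as soon as 4N log 2 ≤ aP (printed without comment; see
`hyp333_of_b0`). [cite: Balaban1982Higgs2, (3.33) p.590] -/
theorem two_rpow_mul_exp_le {N a P : ℝ} (h : 4 * N * Real.log 2 ≤ a * P) :
    (2 : ℝ) ^ (N / 2) * Real.exp (-(a * P / 4)) ≤ Real.exp (-(a * P / 8)) := by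
  rw [Real.rpow_def_of_pos two_pos, ← Real.exp_add]
  exact Real.exp_le_exp.2 (by nlinarith)

/-- **(3.33)** p. 590, PROVED (both inequalities): ∫dφ χ({s‖φ − m‖² > P}) t_{as}(φ − m) ≤ e^{−⅛aP} for a, s > 0 and
4N log 2 ≤ aP. [cite: Balaban1982Higgs2, (3.33) p.590] -/
theorem ineq333 {a s P : ℝ} (ha : 0 < a) (hs : 0 < s) (hP : 4 * (Module.finrank ℝ V : ℝ) * Real.log 2 ≤ a * P)
    (m : V) :
    ∫ φ : V, (if P < s * ‖φ - m‖ ^ 2 then (1 : ℝ) else 0) * B1RT.rtKernel (a * s) (φ - m)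
      ≤ Real.exp (-(a * P / 8)) :=
  (ineq333_first ha hs m).trans (two_rpow_mul_exp_le hP)

/-- p(ℓ) ≥ b₀ at every scale ℓ ≤ 1 (p(ℓ) = b₀(1 + log ℓ⁻¹)^p with log ℓ⁻¹ ≥ 0, p ≥ 0, b₀ ≥ 0; p. 557).
[cite: Balaban1982Higgs2, p.557] -/
theorem b0_le_pFn {b₀ p ℓ : ℝ} (hb : 0 ≤ b₀) (hp : 0 ≤ p) (hℓ : 0 < ℓ) (hℓ1 : ℓ ≤ 1) : b₀ ≤ B2.pFn b₀ p ℓ := by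
  unfold B2.pFn
  have hlog : 0 ≤ Real.log ℓ⁻¹ := Real.log_nonneg (one_le_inv_iff₀.2 ⟨hℓ, hℓ1⟩)
  have h1 : (1 : ℝ) ≤ (1 + Real.log ℓ⁻¹) ^ p := Real.one_le_rpow (by linarith) hp
  calc b₀ = b₀ * 1 := (mul_one _).symm
    _ ≤ b₀ * (1 + Real.log ℓ⁻¹) ^ p := mul_le_mul_of_nonneg_left h1 hb

/-- The implicit hypothesis of the second "≤" in (3.33) holds at EVERY scale ℓ = L^kε ∈ (0,1] once a b₀² ≥ 4N log 2
(b₀ is a large constant of the construction). [cite: Balaban1982Higgs2, (3.33) p.590] -/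
theorem hyp333_of_b0 {N a b₀ p ℓ : ℝ} (ha : 0 ≤ a) (hb : 0 ≤ b₀) (hp : 0 ≤ p) (hℓ : 0 < ℓ) (hℓ1 : ℓ ≤ 1)
    (hab : 4 * N * Real.log 2 ≤ a * b₀ ^ 2) : 4 * N * Real.log 2 ≤ a * B2.pFn b₀ p ℓ ^ 2 := by
  have h := b0_le_pFn hb hp hℓ hℓ1
  have h2 : b₀ ^ 2 ≤ B2.pFn b₀ p ℓ ^ 2 := pow_le_pow_left₀ hb h 2
  exact hab.trans (mul_le_mul_of_nonneg_left h2 ha)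

/-- **(3.33) IN THE PRINTED COORDINATES** p. 590, PROVED: with ℓ = L^kε ∈ (0,1], the kernel precision a·ℓ^{d−2} =
`B1RT.prec a ℓ d`, the threshold p(ℓ)² = (`B2.pFn b₀ p ℓ`)², and constants with a b₀² ≥ 4N log 2:
∫dφ_{k+1}(y) χ({ℓ^{d−2}|φ_{k+1}(y) − (Q(Ã^ε)φ_k)(y)|² > p(ℓ)²})·t(φ_{k+1}(y) − (Q(Ã^ε)φ_k)(y)) ≤ exp(−⅛ a p(ℓ)²).
[cite: Balaban1982Higgs2, (3.33) p.590] -/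
theorem ineq333_printed {a b₀ p ℓ : ℝ} (ha : 0 < a) (hb : 0 ≤ b₀) (hp : 0 ≤ p) (hℓ : 0 < ℓ) (hℓ1 : ℓ ≤ 1)
    (hab : 4 * (Module.finrank ℝ V : ℝ) * Real.log 2 ≤ a * b₀ ^ 2) (d : ℕ) (m : V) :
    ∫ φ : V, (if B2.pFn b₀ p ℓ ^ 2 < ℓ ^ ((d : ℤ) - 2) * ‖φ - m‖ ^ 2 then (1 : ℝ) else 0) *
        B1RT.rtKernel (B1RT.prec a ℓ d) (φ - m)
      ≤ Real.exp (-(a * B2.pFn b₀ p ℓ ^ 2 / 8)) := by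
  rw [B1RT.prec_eq]
  exact ineq333 ha (zpow_pos hℓ _) (hyp333_of_b0 ha.le hb hp hℓ hℓ1 hab) m

/-! ## v1.1 (gen 3 append): (3.36) p. 591 — the substitution Φ = √2Φ′ -/

/-- **(3.36)** p. 591, KERNEL: *"In the integral over Φ we make the transformation Φ = √2Φ′ and we get ∫dΦ′ Z(Ã^ε)
exp(−½⟨Φ′, Δ(Ã^ε)Φ′⟩) exp ½log2 Σ_{k=0}^K |Λ_k|. (3.36)"* — for a function q homogeneous of degree 2 on a real
finite-dimensional inner product space E of dimension n (⟨Φ, ΔΦ⟩ on the space of the configurations Φ, n = the number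
of real integration variables) and a constant Z: ∫dΦ Z e^{−¼q(Φ)} = 2^{n/2} ∫dΦ′ Z e^{−½q(Φ′)} (Lebesgue measure scales
by (√2)^n).  DICTIONARY: `E` ↤ the configurations Φ on ⋃_k Λ_k, `q` ↤ ⟨Φ, Δ(Ã^ε)Φ⟩, `Z` ↤ Z(Ã^ε), n = `finrank ℝ E` ↤
the printed Σ_k |Λ_k| (counted in real components). [cite: Balaban1982Higgs2, (3.36) p.591] -/
theorem eq336 {E : Type*} [NormedAddCommGroup E] [InnerProductSpace ℝ E] [FiniteDimensional ℝ E] [MeasurableSpace E]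
    [BorelSpace E] (Z : ℝ) (q : E → ℝ) (hq : ∀ (c : ℝ) (x : E), q (c • x) = c ^ 2 * q x) :
    ∫ Φ : E, Z * Real.exp (-(q Φ / 4))
      = (2 : ℝ) ^ ((Module.finrank ℝ E : ℝ) / 2) * ∫ Φ' : E, Z * Real.exp (-(q Φ' / 2)) := by
  -- the substitution Φ = √2 • Φ′
  have hsub := Measure.integral_comp_smul (volume : Measure E) (fun Φ : E => Z * Real.exp (-(q Φ / 4)))
    (Real.sqrt 2)
  have h2 : ∀ Φ' : E, Z * Real.exp (-(q (Real.sqrt 2 • Φ') / 4)) = Z * Real.exp (-(q Φ' / 2)) := by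
    intro Φ'
    rw [hq, Real.sq_sqrt (by norm_num : (0 : ℝ) ≤ 2)]
    ring_nf
  simp only [h2] at hsub
  -- |((√2)^n)⁻¹| = 2^{−n/2}
  have hpow : |((Real.sqrt 2) ^ Module.finrank ℝ E)⁻¹| = ((2 : ℝ) ^ ((Module.finrank ℝ E : ℝ) / 2))⁻¹ := by
    rw [abs_inv, abs_of_pos (pow_pos (Real.sqrt_pos.2 (by norm_num : (0 : ℝ) < 2)) _), Real.sqrt_eq_rpow,
      ← Real.rpow_natCast, ← Real.rpow_mul (by norm_num : (0 : ℝ) ≤ 2)]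
    congr 2
    ring
  rw [hpow, smul_eq_mul] at hsub
  have h2pos : 0 < (2 : ℝ) ^ ((Module.finrank ℝ E : ℝ) / 2) := Real.rpow_pos_of_pos (by norm_num) _
  rw [hsub, ← mul_assoc, mul_inv_cancel₀ h2pos.ne', one_mul]

/-- (3.36) with the factor written as printed, exp(½ log 2 · n). [cite: Balaban1982Higgs2, (3.36) p.591] -/
theorem eq336_exp {E : Type*} [NormedAddCommGroup E] [InnerProductSpace ℝ E] [FiniteDimensional ℝ E]
    [MeasurableSpace E] [BorelSpace E] (Z : ℝ) (q : E → ℝ) (hq : ∀ (c : ℝ) (x : E), q (c • x) = c ^ 2 * q x) :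
    ∫ Φ : E, Z * Real.exp (-(q Φ / 4))
      = Real.exp (Real.log 2 / 2 * (Module.finrank ℝ E : ℝ)) * ∫ Φ' : E, Z * Real.exp (-(q Φ' / 2)) := by
  rw [eq336 Z q hq, Real.rpow_def_of_pos (by norm_num : (0 : ℝ) < 2)]
  congr 2
  ring

/-- The quadratic form of a symmetric bilinear pairing is homogeneous of degree 2 — the hypothesis of `eq336` for
q(Φ) = ⟨Φ, ΔΦ⟩ with Δ linear. [cite: Balaban1982Higgs2, (3.36) p.591] -/
theorem quadForm_smul {E : Type*} [NormedAddCommGroup E] [InnerProductSpace ℝ E] (Δ : E →ₗ[ℝ] E) (c : ℝ) (x : E) :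
    inner ℝ (c • x) (Δ (c • x)) = c ^ 2 * inner ℝ x (Δ x) := by
  rw [map_smul, inner_smul_left, inner_smul_right]
  simp only [conj_trivial]
  ring

end GaussTail

end Literature.MathematicalPhysics.QuantumFieldTheory.Balaban1983to89.B2Sect3BSmallFactors
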